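import Summits.BirchSwinnertonDyer.BirchSwinnertonDyer.Theorems.PrintCFramBottomClassIndexLawFiveLeHerbrandEigenspaceProjectors
import Mathlib.GroupTheory.FiniteAbelian.Duality
import Mathlib.Algebra.DirectSum.Module
import HarnessLib

/-!
# Route `PrintCFram`, crux C2 `BottomClassIndexLawFiveLe` (stmt-BirchSwinnertonDyer-20372), line
# `eisenstein-resource-bdp-line` v10, Stub H `stub_bottomResidualSelmer_trivial_of_bernoulliPair`, typing item T3 of
# `Lines/herbrand-regular-locus-M1-anatomy.md` §8, part 2: THE DECOMPOSITION `V = ⊕_χ V^{(χ)}` FOR A FINITE ABELIAN GROUP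
# AND THE `θ`-PART OF A SUBGROUP AS THE SUM OVER THE LIFTS OF `θ` (anatomy §5 "the two lifts")
# (cell `bsd-print-cfram`, seat `bsd-line-cfram-p1-w4` g4; helper `--supports` 20372; 0 facts, 0 defs)

HONEST FRAMING. Nothing about BSD is proved here. Pure algebra continuing `…HerbrandEigenspaceProjectors` (the
`χ`-part `V^{(χ)} = ⨅ g, eigenspace (ρ g) (χ g)` and its projector `e_χ = ⅟|G| • Σ_g χ(g⁻¹) • ρ g`, both written
out, no definition). Here `G` is a finite ABELIAN group of order invertible in a DOMAIN `k` having enough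
`exp(G)`-th roots of unity (Mathlib `HasEnoughRootsOfUnity k (Monoid.exponent G)`; e.g. `k = ℤ_p`, `𝔽_p`, `ℚ_p` and
`G = Gal(L/ℚ)` of exponent dividing `p − 1` as in the herbrand anatomy, all characters `ℤ_p^×`-valued):
* `finite_monoidHom_units`, `card_monoidHom_units_eq` — the dual group `G →* kˣ` is finite of order `|G|` (Mathlib
  `CommGroup.card_monoidHom_of_hasEnoughRootsOfUnity`); `sum_dual_apply_eq_zero` — **`Σ_χ χ(g) = 0` for `g ≠ 1`**
  (characters separate points, Mathlib `CommGroup.exists_apply_ne_one_of_hasEnoughRootsOfUnity`, + the character-sum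
  lemma of part 1 applied to the dual group);
* **`sum_proj_apply`** — `Σ_χ e_χ = 1` on `V`; hence **`iSup_iInf_eigenspace_eq_top`** (`V = Σ_χ V^{(χ)}`),
  **`iSupIndep_iInf_eigenspace`** (the sum is direct, by the orthogonality of part 1) and `isInternal_iInf_eigenspace`
  (Mathlib `DirectSum.IsInternal`) — for EVERY `k`-module `V`, torsion allowed (`Cl_L ⊗ ℤ_p`);
* restriction to a subgroup `Δ ≤ G` with a character `θ : Δ →* kˣ`: `sum_apply_eq_zero_of_comp_subtype_ne` /
  `proj_apply_eq_zero_of_comp_subtype_ne` (`e_χ` kills the `θ`-part of `ρ|_Δ` unless `χ|_Δ = θ`: average over `Δ`,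
  `|Δ| ∈ kˣ`), whence **`iInf_eigenspace_comp_subtype_eq_iSup`**: `V^{(θ)}_Δ = ⨆_{χ|_Δ = θ} V^{(χ)}` — for `Δ` of
  index `2` in `G = ⟨c⟩ × Δ` this is anatomy §5's `X^{(θ)} = X^{(θ₀)} ⊕ X^{(θ₀ε_K)}` (the odd and the even lift).

THEOREMS ONLY; no definition, no named fact, no `sorry`; imports no `Theses` module. BSD is not proved by any of
this; no summit statement is proved by this seat.
References: [Washington1997] §6.3; [Lang1990] Ch. 1 §3; [SerreLinearRepresentations1977] §2.6 Thm. 8, §3.1.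
-/

set_option autoImplicit false
-- `…BirchSwinnertonDyer.BirchSwinnertonDyer.Theorems…` is the problem's mandated namespace (D-0017).
set_option linter.dupNamespace false

namespace Summit.BirchSwinnertonDyer.BirchSwinnertonDyer.Theorems.PrintCFram.HerbrandEigenspace

open Module Module.End

/-! ## The dual group `G →* kˣ` and its character sums -/

section Dual

variable {k G : Type*} [CommRing k] [CommGroup G] [Fintype G] [HasEnoughRootsOfUnity k (Monoid.exponent G)]

/-- The dual group `G →* kˣ` of a finite abelian group is finite when `k` has enough roots of unity (it has `|G|`
elements, Mathlib `CommGroup.card_monoidHom_of_hasEnoughRootsOfUnity`). [folklore] -/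
theorem finite_monoidHom_units : Finite (G →* kˣ) := by
  apply Nat.finite_of_card_ne_zero
  rw [CommGroup.card_monoidHom_of_hasEnoughRootsOfUnity G k]
  exact Nat.card_pos.ne'

/-- `#(G →* kˣ) = #G`. [folklore] -/
theorem card_monoidHom_units_eq [Fintype (G →* kˣ)] : Fintype.card (G →* kˣ) = Fintype.card G := by
  rw [← Nat.card_eq_fintype_card, ← Nat.card_eq_fintype_card]
  exact CommGroup.card_monoidHom_of_hasEnoughRootsOfUnity G k

/-- **`Σ_χ χ(g) = 0` for `g ≠ 1`** (sum over the dual group; characters separate the points of `G`).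
[cite: Washington1997, §6.3] [folklore] -/
theorem sum_dual_apply_eq_zero [IsDomain k] [Fintype (G →* kˣ)] {g : G} (hg : g ≠ 1) :
    ∑ χ : G →* kˣ, ((χ g : kˣ) : k) = 0 := by
  obtain ⟨φ, hφ⟩ := CommGroup.exists_apply_ne_one_of_hasEnoughRootsOfUnity G k hg
  have hne : (MonoidHom.eval g : (G →* kˣ) →* kˣ) ≠ 1 := by
    intro h
    exact hφ (by simpa using DFunLike.congr_fun h φ)
  simpa using sum_units_val_eq_zero_of_ne_one (MonoidHom.eval g : (G →* kˣ) →* kˣ) hne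

/-- `Σ_χ χ(1) = #G`. [folklore] -/
theorem sum_dual_apply_one [Fintype (G →* kˣ)] :
    ∑ χ : G →* kˣ, ((χ 1 : kˣ) : k) = (Fintype.card G : k) := by
  simp only [map_one, Units.val_one, Finset.sum_const, Finset.card_univ, nsmul_eq_mul, mul_one,
    card_monoidHom_units_eq]

end Dual

/-! ## `Σ_χ e_χ = 1` and the decomposition `V = ⊕_χ V^{(χ)}` -/

section Decomposition

variable {k G V : Type*} [CommRing k] [IsDomain k] [CommGroup G] [Fintype G] [AddCommGroup V] [Module k V]
  (ρ : Representation k G V) [Invertible (Fintype.card G : k)]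

/-- **The sum `Σ_χ V^{(χ)}` is direct** (`iSupIndep`): `V^{(χ)} ∩ Σ_{ψ ≠ χ} V^{(ψ)} = 0`, since `e_χ` fixes the first and
kills the second (orthogonality over a domain; no roots of unity needed). [cite: Washington1997, §6.3] [folklore] -/
theorem iSupIndep_iInf_eigenspace :
    iSupIndep fun χ : G →* kˣ => ⨅ g : G, eigenspace (ρ g) (χ g : k) := by
  intro χ
  rw [Submodule.disjoint_def]
  intro v hv hv'
  have hker : (⨆ (ψ : G →* kˣ) (_ : ψ ≠ χ), ⨅ g : G, eigenspace (ρ g) (ψ g : k)) ≤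
      LinearMap.ker (⅟(Fintype.card G : k) • ∑ g : G, ((χ g⁻¹ : kˣ) : k) • ρ g) :=
    iSup₂_le fun ψ hψ w hw => LinearMap.mem_ker.mpr (proj_apply_eq_zero_of_mem_of_ne ρ (Ne.symm hψ) hw)
  rw [← proj_eq_self ρ χ hv]
  exact LinearMap.mem_ker.mp (hker hv')

variable [HasEnoughRootsOfUnity k (Monoid.exponent G)]

/-- **`Σ_χ e_χ v = v`**: the projectors of all the characters sum to the identity
(`Σ_χ χ(g⁻¹) = |G|·[g = 1]`). [cite: Washington1997, §6.3] [cite: SerreLinearRepresentations1977, §2.6 Thm. 8] [folklore] -/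
theorem sum_proj_apply [Fintype (G →* kˣ)] (v : V) :
    ∑ χ : G →* kˣ, (⅟(Fintype.card G : k) • ∑ g : G, ((χ g⁻¹ : kˣ) : k) • ρ g) v = v := by
  simp only [proj_apply]
  rw [← Finset.smul_sum, Finset.sum_comm]
  simp only [← Finset.sum_smul]
  rw [Finset.sum_eq_single (1 : G)]
  · rw [inv_one, sum_dual_apply_one, map_one, Module.End.one_apply, smul_smul, invOf_mul_self, one_smul]
  · intro g _ hg
    rw [sum_dual_apply_eq_zero (inv_ne_one.mpr hg), zero_smul]
  · intro h
    exact absurd (Finset.mem_univ _) h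

/-- **`V = Σ_χ V^{(χ)}`** for every `k`-module `V` (torsion allowed). [cite: Washington1997, §6.3] [folklore] -/
theorem iSup_iInf_eigenspace_eq_top :
    (⨆ χ : G →* kˣ, ⨅ g : G, eigenspace (ρ g) (χ g : k)) = ⊤ := by
  haveI : Fintype (G →* kˣ) := @Fintype.ofFinite _ finite_monoidHom_units
  refine eq_top_iff.mpr fun v _ => ?_
  rw [← sum_proj_apply ρ v]
  exact Submodule.sum_mem _ fun χ _ =>
    Submodule.mem_iSup_of_mem (p := fun χ : G →* kˣ => ⨅ g : G, eigenspace (ρ g) (χ g : k)) χ (proj_mem ρ χ v)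

/-- **`V = ⊕_χ V^{(χ)}`** as an internal direct sum (Mathlib `DirectSum.IsInternal`).
[cite: Washington1997, §6.3] [cite: SerreLinearRepresentations1977, §2.6 Thm. 8] [folklore] -/
theorem isInternal_iInf_eigenspace [DecidableEq (G →* kˣ)] :
    DirectSum.IsInternal fun χ : G →* kˣ => ⨅ g : G, eigenspace (ρ g) (χ g : k) :=
  (DirectSum.isInternal_submodule_iff_iSupIndep_and_iSup_eq_top _).mpr
    ⟨iSupIndep_iInf_eigenspace ρ, iSup_iInf_eigenspace_eq_top ρ⟩

/-- A vector is determined by its `χ`-components: `e_χ v = e_χ w` for all `χ` ⟹ `v = w`. [folklore] -/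
theorem eq_of_forall_proj_eq {v w : V}
    (h : ∀ χ : G →* kˣ, (⅟(Fintype.card G : k) • ∑ g : G, ((χ g⁻¹ : kˣ) : k) • ρ g) v =
      (⅟(Fintype.card G : k) • ∑ g : G, ((χ g⁻¹ : kˣ) : k) • ρ g) w) : v = w := by
  haveI : Fintype (G →* kˣ) := @Fintype.ofFinite _ finite_monoidHom_units
  rw [← sum_proj_apply ρ v, ← sum_proj_apply ρ w]
  exact Finset.sum_congr rfl fun χ _ => h χ

/-- `V = 0` iff every `χ`-part vanishes. [folklore] -/
theorem eq_bot_iff_forall_iInf_eigenspace_eq_bot (N : Submodule k V) (hN : ∀ g : G, N ≤ N.comap (ρ g)) :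
    (∀ χ : G →* kˣ, N ⊓ (⨅ g : G, eigenspace (ρ g) (χ g : k)) = ⊥) → N = ⊥ := by
  intro h
  haveI : Fintype (G →* kˣ) := @Fintype.ofFinite _ finite_monoidHom_units
  refine (Submodule.eq_bot_iff _).mpr fun v hv => ?_
  rw [← sum_proj_apply ρ v]
  refine Finset.sum_eq_zero fun χ _ => ?_
  have hmem : (⅟(Fintype.card G : k) • ∑ g : G, ((χ g⁻¹ : kˣ) : k) • ρ g) v ∈
      N ⊓ (⨅ g : G, eigenspace (ρ g) (χ g : k)) := by
    refine Submodule.mem_inf.mpr ⟨?_, proj_mem ρ χ v⟩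
    rw [proj_apply]
    exact Submodule.smul_mem _ _ (Submodule.sum_mem _ fun g _ => Submodule.smul_mem _ _ (hN g hv))
  rw [h χ] at hmem
  exact (Submodule.mem_bot k).mp hmem

end Decomposition

/-! ## The `θ`-part of a subgroup `Δ ≤ G` is the sum of the `χ`-parts over the lifts `χ|_Δ = θ` -/

section Subgroup

variable {k G V : Type*} [CommRing k] [IsDomain k] [CommGroup G] [Fintype G] [AddCommGroup V] [Module k V]
  (ρ : Representation k G V) (Δ : Subgroup G) (θ : Δ →* kˣ) (χ : G →* kˣ)

omit [IsDomain k] [Fintype G] in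
/-- A `χ`-part lies in the `θ`-part of `Δ` when `χ|_Δ = θ`. [folklore] -/
theorem iInf_eigenspace_le_of_comp_subtype_eq (h : χ.comp Δ.subtype = θ) :
    (⨅ g : G, eigenspace (ρ g) (χ g : k)) ≤ ⨅ δ : Δ, eigenspace ((ρ.comp Δ.subtype) δ) (θ δ : k) := by
  intro v hv
  rw [mem_iInf_eigenspace_iff] at hv ⊢
  intro δ
  rw [← h]
  exact hv δ

omit [IsDomain k] in
/-- For `δ ∈ Δ` and `v` in the `θ`-part of `Δ`: `S_χ v = χ(δ⁻¹)θ(δ) • S_χ v` (reindex `g ↦ g δ`). [folklore] -/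
theorem sum_apply_eq_smul_of_mem (δ : Δ) {v : V}
    (hv : v ∈ ⨅ δ : Δ, eigenspace ((ρ.comp Δ.subtype) δ) (θ δ : k)) :
    (∑ g : G, ((χ g⁻¹ : kˣ) : k) • ρ g) v =
      (((χ (δ : G)⁻¹ : kˣ) : k) * (θ δ : k)) • (∑ g : G, ((χ g⁻¹ : kˣ) : k) • ρ g) v := by
  rw [mem_iInf_eigenspace_iff] at hv
  have hδ : ρ (δ : G) v = (θ δ : k) • v := hv δ
  rw [sum_apply]
  calc ∑ g : G, ((χ g⁻¹ : kˣ) : k) • ρ g v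
      = ∑ g : G, ((χ (g * δ)⁻¹ : kˣ) : k) • ρ (g * δ) v :=
        (Fintype.sum_bijective (fun g : G => g * (δ : G)) (Group.mulRight_bijective (δ : G)) _ _
          fun _ => rfl).symm
    _ = ∑ g : G, (((χ (δ : G)⁻¹ : kˣ) : k) * (θ δ : k)) • (((χ g⁻¹ : kˣ) : k) • ρ g v) := by
        refine Finset.sum_congr rfl fun g _ => ?_
        rw [map_mul ρ, Module.End.mul_apply, hδ, map_smul, mul_inv_rev, map_mul, Units.val_mul, smul_smul,
          smul_smul]
        ring_nf
    _ = (((χ (δ : G)⁻¹ : kˣ) : k) * (θ δ : k)) • ∑ g : G, ((χ g⁻¹ : kˣ) : k) • ρ g v := by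
        rw [Finset.smul_sum]

/-- **`S_χ` kills the `θ`-part of `Δ` unless `χ|_Δ = θ`**: averaging `sum_apply_eq_smul_of_mem` over `δ ∈ Δ`,
`|Δ| • S_χ v = (Σ_δ (χ|_Δ⁻¹θ)(δ)) • S_χ v = 0`, and `|Δ|` divides the unit `|G|`. [cite: Washington1997, §6.3] [folklore] -/
theorem sum_apply_eq_zero_of_comp_subtype_ne [Invertible (Fintype.card G : k)] (h : χ.comp Δ.subtype ≠ θ) {v : V}
    (hv : v ∈ ⨅ δ : Δ, eigenspace ((ρ.comp Δ.subtype) δ) (θ δ : k)) :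
    (∑ g : G, ((χ g⁻¹ : kˣ) : k) • ρ g) v = 0 := by
  classical
  set x := (∑ g : G, ((χ g⁻¹ : kˣ) : k) • ρ g) v with hx
  have hne : (χ.comp Δ.subtype)⁻¹ * θ ≠ 1 := fun e => h (inv_mul_eq_one.mp e)
  have hsum : (Fintype.card Δ : k) • x = 0 := by
    calc (Fintype.card Δ : k) • x = ∑ δ : Δ, x := by
          rw [Finset.sum_const, Finset.card_univ, Nat.cast_smul_eq_nsmul]
      _ = ∑ δ : Δ, ((((χ.comp Δ.subtype)⁻¹ * θ) δ : kˣ) : k) • x := by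
          refine Finset.sum_congr rfl fun δ _ => ?_
          rw [MonoidHom.mul_apply, MonoidHom.inv_apply, Units.val_mul, MonoidHom.comp_apply, Subgroup.subtype_apply,
            ← map_inv]
          exact sum_apply_eq_smul_of_mem ρ Δ θ χ δ hv
      _ = 0 := by rw [← Finset.sum_smul, sum_units_val_eq_zero_of_ne_one _ hne, zero_smul]
  have hunit : IsUnit (Fintype.card Δ : k) := by
    have hG : IsUnit (Fintype.card G : k) := isUnit_of_invertible _
    have hmul : (Fintype.card Δ : k) * (Δ.index : k) = Fintype.card G := by
      rw [← Nat.cast_mul, ← Nat.card_eq_fintype_card, Subgroup.card_mul_index, Nat.card_eq_fintype_card]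
    rw [← hmul] at hG
    exact isUnit_of_mul_isUnit_left hG
  obtain ⟨u, hu⟩ := hunit
  rw [← hu] at hsum
  simpa using congrArg (fun y => ((u⁻¹ : kˣ) : k) • y) hsum

/-- `e_χ` kills the `θ`-part of `Δ` unless `χ|_Δ = θ`. [folklore] -/
theorem proj_apply_eq_zero_of_comp_subtype_ne [Invertible (Fintype.card G : k)] (h : χ.comp Δ.subtype ≠ θ) {v : V}
    (hv : v ∈ ⨅ δ : Δ, eigenspace ((ρ.comp Δ.subtype) δ) (θ δ : k)) :
    (⅟(Fintype.card G : k) • ∑ g : G, ((χ g⁻¹ : kˣ) : k) • ρ g) v = 0 := by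
  rw [LinearMap.smul_apply, sum_apply_eq_zero_of_comp_subtype_ne ρ Δ θ χ h hv, smul_zero]

variable [HasEnoughRootsOfUnity k (Monoid.exponent G)] [Invertible (Fintype.card G : k)]

/-- **The `θ`-part of `Δ` is the sum of the `χ`-parts over the characters `χ` of `G` lifting `θ`**:
`V^{(θ)}_Δ = ⨆_{χ|_Δ = θ} V^{(χ)}` (`v = Σ_χ e_χ v` and `e_χ v = 0` unless `χ|_Δ = θ`). For `G = ⟨c⟩ × Δ`, `c² = 1`, these
are the two lifts `θ₀`, `θ₀ε` of anatomy §5. [cite: Washington1997, §6.3] [folklore] -/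
theorem iInf_eigenspace_comp_subtype_eq_iSup :
    (⨅ δ : Δ, eigenspace ((ρ.comp Δ.subtype) δ) (θ δ : k)) =
      ⨆ (χ : G →* kˣ) (_ : χ.comp Δ.subtype = θ), ⨅ g : G, eigenspace (ρ g) (χ g : k) := by
  classical
  haveI : Fintype (G →* kˣ) := @Fintype.ofFinite _ finite_monoidHom_units
  refine le_antisymm (fun v hv => ?_) (iSup₂_le fun χ hχ => iInf_eigenspace_le_of_comp_subtype_eq ρ Δ θ χ hχ)
  rw [← sum_proj_apply ρ v]
  refine Submodule.sum_mem _ fun χ _ => ?_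
  by_cases hχ : χ.comp Δ.subtype = θ
  · exact Submodule.mem_iSup_of_mem (p := fun χ : G →* kˣ =>
        ⨆ (_ : χ.comp Δ.subtype = θ), ⨅ g : G, eigenspace (ρ g) (χ g : k)) χ
      (Submodule.mem_iSup_of_mem (p := fun _ : χ.comp Δ.subtype = θ => ⨅ g : G, eigenspace (ρ g) (χ g : k)) hχ
        (proj_mem ρ χ v))
  · rw [proj_apply_eq_zero_of_comp_subtype_ne ρ Δ θ χ hχ hv]
    exact Submodule.zero_mem _

/-- The `θ`-part of `Δ` vanishes iff every `χ`-part with `χ|_Δ = θ` vanishes. [folklore] -/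
theorem iInf_eigenspace_comp_subtype_eq_bot_iff :
    (⨅ δ : Δ, eigenspace ((ρ.comp Δ.subtype) δ) (θ δ : k)) = ⊥ ↔
      ∀ χ : G →* kˣ, χ.comp Δ.subtype = θ → (⨅ g : G, eigenspace (ρ g) (χ g : k)) = ⊥ := by
  rw [iInf_eigenspace_comp_subtype_eq_iSup ρ Δ θ, iSup₂_eq_bot]

end Subgroup

end Summit.BirchSwinnertonDyer.BirchSwinnertonDyer.Theorems.PrintCFram.HerbrandEigenspace
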